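import Literature.Probability.Percolation.ZdRingBarriers
import HarnessLib

/-!
# Corner rings: open and closed-dual quarter-circuits at the right corners of the rectangle

Topic `Literature/Probability/Percolation`; bond percolation on `ℤ² = Site 2` at `p = 1/2`.
DEFINITIONS with bodies (`cornerRingTop/Bot`, `dualCornerRingTop/Bot`, `cornerSitesTop/Bot`) and
PROOFS (no named fact).  A brick of the EXTERNAL per-scale lemma of Kesten's arm-separation
theorem for four alternating arms of bond percolation on `ℤ²`, cluster–frontier form: in the side
rectangle `R = [0,M] × [0,N]` the objects (open and closed-dual crossing clusters,
`ZdFrontierEvent.lean`, `ZdDualFrame.lean`) have their tips on the right side `x = M`; the fence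
and ring constructions at a tip (`ZdFrontierFence.lean`, `ZdRingBarriers.lean`) need the tip to be
at distance `≳ ρ` from the two right corners `(M, N)` and `(M, 0)`.  This is secured, as for the
tips themselves in P. Nolin, EJP 13 (2008), §4.4, proof of Lemma 15 [arXiv 0711.4948: Lemma 14,
p. 11] ("a black circuit … preventing white crossings to arrive"), by UNCONDITIONAL quarter-rings
around the corners (RSW in two rectangles meeting in a square, Bollobás–Riordan 2006, Ch. 3):

* `cornerRingTop M N ρ` / `cornerRingBot M ρ` — an open left–right crossing of
  `[M-2ρ, M] × [N-2ρ, N-ρ]` and an open top–bottom crossing of `[M-2ρ, M-ρ] × [N-2ρ, N]` (resp.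
  the mirror images at the bottom corner); `dualCornerRingTop/Bot` — the closed-dual analogues
  (`dualLRFaceCrossing`, `dualTBFaceCrossing`);
* probability `≥ c²` (`le_real_cornerRingTop`, …, RSW ratio `7` and Harris), locality on the pairs
  of `cornerSitesTop/Bot M N ρ`, pairwise disjoint along the scales `r 4^k`
  (`disjoint_cornerSitesTop_sym2_pow`, …), whence **no corner ring at `K` scales has probability
  `≤ (1 - c²)^K`** (`real_noCornerRingTop_le`, …, product formula `real_inter_biInter_compl_le`
  with the trivial event);
* the BARRIERS (first-exit case analysis + Bollobás–Riordan's crossing lemma in a box, as in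
  `ZdRingBarriers.lean`): an open corner ring keeps every walk of faces INSIDE `R` crossing
  `ω`-closed edges from joining a face near the corner to a face far from it
  (`cornerRingTop_blocks_faceWalk`, `cornerRingBot_blocks_faceWalk`), and a closed-dual corner
  ring does the same for `ω`-open walks of sites of `R` (`dualCornerRingTop_blocks_walk`,
  `dualCornerRingBot_blocks_walk`).

## References

* P. Nolin, *Near-critical percolation in two dimensions*, EJP 13 (2008), §4.4, proof of
  Lemma 15 (arXiv 0711.4948: Lemma 14, p. 11) [Nolin2008].
* B. Bollobás, O. Riordan, *Percolation* (2006), Ch. 3, Lemma 1, Lemma 4, Thm. 8 [BollobasRiordan2006].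
* H. Kesten, *Scaling relations for 2D-percolation*, CMP 109 (1987), §2, Lemma 4 [KestenScalingCMP1987].
-/

noncomputable section

open SimpleGraph Finset

namespace Literature.Probability.Percolation

open LatticeModels _root_.MeasureTheory

variable {M N : ℕ} {ω : BondConfig (Site 2)}

/-! ### The events -/

/-- **Open corner ring at the top-right corner `(M, N)` at scale `ρ`**: an open left–right crossing
of `[M-2ρ, M] × [N-2ρ, N-ρ]` and an open top–bottom crossing of `[M-2ρ, M-ρ] × [N-2ρ, N]`.
[cite: Nolin2008, §4.4, proof of Lemma 15 (arXiv 0711.4948: Lemma 14, p. 11)] -/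
def cornerRingTop (M N ρ : ℕ) : Set (BondConfig (Site 2)) :=
  lrCrossingAt ![(M : ℤ) - 2 * ρ, (N : ℤ) - 2 * ρ] (2 * ρ) ρ ∩ tbCrossingAt' ![(M : ℤ) - 2 * ρ, (N : ℤ) - 2 * ρ] ρ (2 * ρ)

/-- **Open corner ring at the bottom-right corner `(M, 0)` at scale `ρ`**: an open left–right
crossing of `[M-2ρ, M] × [ρ, 2ρ]` and an open top–bottom crossing of `[M-2ρ, M-ρ] × [0, 2ρ]`.
[cite: Nolin2008, §4.4, proof of Lemma 15 (arXiv 0711.4948: Lemma 14, p. 11)] -/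
def cornerRingBot (M ρ : ℕ) : Set (BondConfig (Site 2)) :=
  lrCrossingAt ![(M : ℤ) - 2 * ρ, (ρ : ℤ)] (2 * ρ) ρ ∩ tbCrossingAt' ![(M : ℤ) - 2 * ρ, 0] ρ (2 * ρ)

/-- **Closed-dual corner ring at the top-right corner** at scale `ρ`: a closed-dual left–right
crossing of the face strip `[M-2ρ, M] × [N-2ρ, N-ρ-1]` and a closed-dual top–bottom crossing of the
face strip `[M-2ρ, M-ρ-1] × [N-2ρ, N]`. [cite: Nolin2008, §4.4, proof of Lemma 15 (arXiv 0711.4948: Lemma 14, p. 11)] -/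
def dualCornerRingTop (M N ρ : ℕ) : Set (BondConfig (Site 2)) :=
  dualLRFaceCrossing ![(M : ℤ) - 2 * ρ, (N : ℤ) - 2 * ρ] (2 * ρ) (ρ - 1) ∩
    dualTBFaceCrossing ![(M : ℤ) - 2 * ρ, (N : ℤ) - 2 * ρ] (ρ - 1) (2 * ρ)

/-- **Closed-dual corner ring at the bottom-right corner** at scale `ρ`: a closed-dual left–right
crossing of the face strip `[M-2ρ, M] × [ρ, 2ρ-1]` and a closed-dual top–bottom crossing of the face
strip `[M-2ρ, M-ρ-1] × [-1, 2ρ-1]`. [cite: Nolin2008, §4.4, proof of Lemma 15 (arXiv 0711.4948: Lemma 14, p. 11)] -/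
def dualCornerRingBot (M ρ : ℕ) : Set (BondConfig (Site 2)) :=
  dualLRFaceCrossing ![(M : ℤ) - 2 * ρ, (ρ : ℤ)] (2 * ρ) (ρ - 1) ∩
    dualTBFaceCrossing ![(M : ℤ) - 2 * ρ, -1] (ρ - 1) (2 * ρ)

/-- The open top corner ring is increasing. [folklore] -/
theorem isUpperSet_cornerRingTop (M N ρ : ℕ) : IsUpperSet (cornerRingTop M N ρ) :=
  (isUpperSet_lrCrossingAt _ _ _).inter (isUpperSet_tbCrossingAt' _ _ _)

/-- The open bottom corner ring is increasing. [folklore] -/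
theorem isUpperSet_cornerRingBot (M ρ : ℕ) : IsUpperSet (cornerRingBot M ρ) :=
  (isUpperSet_lrCrossingAt _ _ _).inter (isUpperSet_tbCrossingAt' _ _ _)

/-- The closed-dual top corner ring is decreasing. [folklore] -/
theorem isLowerSet_dualCornerRingTop (M N ρ : ℕ) : IsLowerSet (dualCornerRingTop M N ρ) :=
  (isLowerSet_dualLRFaceCrossing _ _ _).inter (isLowerSet_dualTBFaceCrossing _ _ _)

/-- The closed-dual bottom corner ring is decreasing. [folklore] -/
theorem isLowerSet_dualCornerRingBot (M ρ : ℕ) : IsLowerSet (dualCornerRingBot M ρ) :=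
  (isLowerSet_dualLRFaceCrossing _ _ _).inter (isLowerSet_dualTBFaceCrossing _ _ _)

/-- The open top corner ring is measurable. [folklore] -/
theorem measurableSet_cornerRingTop (M N ρ : ℕ) : MeasurableSet (cornerRingTop M N ρ) :=
  (measurableSet_lrCrossingAt _ _ _).inter (measurableSet_tbCrossingAt' _ _ _)

/-- The open bottom corner ring is measurable. [folklore] -/
theorem measurableSet_cornerRingBot (M ρ : ℕ) : MeasurableSet (cornerRingBot M ρ) :=
  (measurableSet_lrCrossingAt _ _ _).inter (measurableSet_tbCrossingAt' _ _ _)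

/-- The closed-dual top corner ring is measurable. [folklore] -/
theorem measurableSet_dualCornerRingTop (M N ρ : ℕ) : MeasurableSet (dualCornerRingTop M N ρ) :=
  (measurableSet_dualLRFaceCrossing _ _ _).inter (measurableSet_dualTBFaceCrossing _ _ _)

/-- The closed-dual bottom corner ring is measurable. [folklore] -/
theorem measurableSet_dualCornerRingBot (M ρ : ℕ) : MeasurableSet (dualCornerRingBot M ρ) :=
  (measurableSet_dualLRFaceCrossing _ _ _).inter (measurableSet_dualTBFaceCrossing _ _ _)

/-! ### Probabilities -/

/-- The open top corner ring has probability at least `c²` (RSW ratio `7`, Harris). [cite: BollobasRiordan2006, Ch. 3, Thm. 8 and Lemma 4] -/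
theorem le_real_cornerRingTop {c : ℝ} (hc0 : 0 ≤ c) (hc : ∀ l : ℕ, 1 ≤ l → c ≤ crossingProb half (7 * l - 1) (l - 1))
    (M N ρ : ℕ) : c ^ 2 ≤ (bondPercolation (zdGraph 2) half).real (cornerRingTop M N ρ) := by
  rw [sq, cornerRingTop]
  exact le_real_inter_of_upper hc0 hc0 (isUpperSet_lrCrossingAt _ _ _) (isUpperSet_tbCrossingAt' _ _ _)
    (measurableSet_lrCrossingAt _ _ _) (measurableSet_tbCrossingAt' _ _ _)
    (le_real_lrCrossingAt_of_rsw_ratio hc _ (M := 2 * ρ) (n := ρ) (by omega))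
    (le_real_tbCrossingAt'_of_rsw_ratio hc _ (w := ρ) (h := 2 * ρ) (by omega))

/-- The open bottom corner ring has probability at least `c²`. [cite: BollobasRiordan2006, Ch. 3, Thm. 8 and Lemma 4] -/
theorem le_real_cornerRingBot {c : ℝ} (hc0 : 0 ≤ c) (hc : ∀ l : ℕ, 1 ≤ l → c ≤ crossingProb half (7 * l - 1) (l - 1))
    (M ρ : ℕ) : c ^ 2 ≤ (bondPercolation (zdGraph 2) half).real (cornerRingBot M ρ) := by
  rw [sq, cornerRingBot]
  exact le_real_inter_of_upper hc0 hc0 (isUpperSet_lrCrossingAt _ _ _) (isUpperSet_tbCrossingAt' _ _ _)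
    (measurableSet_lrCrossingAt _ _ _) (measurableSet_tbCrossingAt' _ _ _)
    (le_real_lrCrossingAt_of_rsw_ratio hc _ (M := 2 * ρ) (n := ρ) (by omega))
    (le_real_tbCrossingAt'_of_rsw_ratio hc _ (w := ρ) (h := 2 * ρ) (by omega))

/-- The closed-dual top corner ring has probability at least `c²` (`ρ ≥ 1`). [cite: BollobasRiordan2006, Ch. 3, Thm. 8 and Lemma 4] -/
theorem le_real_dualCornerRingTop {c : ℝ} (hc0 : 0 ≤ c) (hc : ∀ l : ℕ, 1 ≤ l → c ≤ crossingProb half (7 * l - 1) (l - 1))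
    (M N : ℕ) {ρ : ℕ} (hρ : 1 ≤ ρ) : c ^ 2 ≤ (bondPercolation (zdGraph 2) half).real (dualCornerRingTop M N ρ) := by
  rw [sq, dualCornerRingTop]
  exact le_real_inter_of_lower hc0 hc0 (isLowerSet_dualLRFaceCrossing _ _ _) (isLowerSet_dualTBFaceCrossing _ _ _)
    (measurableSet_dualLRFaceCrossing _ _ _) (measurableSet_dualTBFaceCrossing _ _ _)
    (le_real_dualLRFaceCrossing_of_rsw_ratio hc _ (M := 2 * ρ) (h := ρ - 1) (by omega))
    (le_real_dualTBFaceCrossing_of_rsw_ratio hc _ (w := ρ - 1) (h := 2 * ρ) (by omega))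

/-- The closed-dual bottom corner ring has probability at least `c²` (`ρ ≥ 1`). [cite: BollobasRiordan2006, Ch. 3, Thm. 8 and Lemma 4] -/
theorem le_real_dualCornerRingBot {c : ℝ} (hc0 : 0 ≤ c) (hc : ∀ l : ℕ, 1 ≤ l → c ≤ crossingProb half (7 * l - 1) (l - 1))
    (M : ℕ) {ρ : ℕ} (hρ : 1 ≤ ρ) : c ^ 2 ≤ (bondPercolation (zdGraph 2) half).real (dualCornerRingBot M ρ) := by
  rw [sq, dualCornerRingBot]
  exact le_real_inter_of_lower hc0 hc0 (isLowerSet_dualLRFaceCrossing _ _ _) (isLowerSet_dualTBFaceCrossing _ _ _)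
    (measurableSet_dualLRFaceCrossing _ _ _) (measurableSet_dualTBFaceCrossing _ _ _)
    (le_real_dualLRFaceCrossing_of_rsw_ratio hc _ (M := 2 * ρ) (h := ρ - 1) (by omega))
    (le_real_dualTBFaceCrossing_of_rsw_ratio hc _ (w := ρ - 1) (h := 2 * ρ) (by omega))

/-! ### Locality and disjointness along scales -/

/-- Sites read by the top corner rings at scale `ρ`. [folklore] -/
def cornerSitesTop (M N ρ : ℕ) : Finset (Site 2) :=
  (Finset.Icc ![(M : ℤ) - 2 * ρ, (N : ℤ) - 2 * ρ] ![(M : ℤ) + 1, (N : ℤ) + 1]).filter fun x =>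
    x 0 + ρ ≤ M ∨ x 1 + ρ ≤ N

/-- Sites read by the bottom corner rings at scale `ρ`. [folklore] -/
def cornerSitesBot (M ρ : ℕ) : Finset (Site 2) :=
  (Finset.Icc ![(M : ℤ) - 2 * ρ, -1] ![(M : ℤ) + 1, 2 * (ρ : ℤ)]).filter fun x => x 0 + ρ ≤ M ∨ (ρ : ℤ) ≤ x 1

/-- Coordinates of the top corner sites. [folklore] -/
theorem mem_cornerSitesTop_iff {ρ : ℕ} {x : Site 2} : x ∈ cornerSitesTop M N ρ ↔
    ((M : ℤ) - 2 * ρ ≤ x 0 ∧ x 0 ≤ M + 1 ∧ (N : ℤ) - 2 * ρ ≤ x 1 ∧ x 1 ≤ N + 1) ∧ (x 0 + ρ ≤ M ∨ x 1 + ρ ≤ N) := by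
  rw [cornerSitesTop, Finset.mem_filter, Finset.mem_Icc]
  simp only [Pi.le_def, Fin.forall_fin_two, Matrix.cons_val_zero, Matrix.cons_val_one]
  tauto

/-- Coordinates of the bottom corner sites. [folklore] -/
theorem mem_cornerSitesBot_iff {ρ : ℕ} {x : Site 2} : x ∈ cornerSitesBot M ρ ↔
    ((M : ℤ) - 2 * ρ ≤ x 0 ∧ x 0 ≤ M + 1 ∧ -1 ≤ x 1 ∧ x 1 ≤ 2 * ρ) ∧ (x 0 + ρ ≤ M ∨ (ρ : ℤ) ≤ x 1) := by
  rw [cornerSitesBot, Finset.mem_filter, Finset.mem_Icc]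
  simp only [Pi.le_def, Fin.forall_fin_two, Matrix.cons_val_zero, Matrix.cons_val_one]
  tauto

/-- The open top corner ring is read on the pairs of `cornerSitesTop`. [folklore] -/
theorem determinedBy_cornerRingTop (M N ρ : ℕ) : DeterminedBy (cornerRingTop M N ρ) ↑((cornerSitesTop M N ρ).sym2) := by
  refine ((determinedBy_openCrossing_image _ _ _ _).mono (Finset.coe_subset.2 (Finset.sym2_mono fun x hx => ?_))).inter
    ((determinedBy_openCrossing_image _ _ _ _).mono (Finset.coe_subset.2 (Finset.sym2_mono fun x hx => ?_)))
  all_goals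
    rw [Finset.mem_image] at hx
    obtain ⟨y, hy, rfl⟩ := hx
    rw [mem_rectangle_iff] at hy
    rw [mem_cornerSitesTop_iff]
    simp only [Pi.add_apply, Matrix.cons_val_zero, Matrix.cons_val_one, Nat.cast_mul, Nat.cast_ofNat] at hy ⊢
    omega

/-- The open bottom corner ring is read on the pairs of `cornerSitesBot`. [folklore] -/
theorem determinedBy_cornerRingBot (M ρ : ℕ) : DeterminedBy (cornerRingBot M ρ) ↑((cornerSitesBot M ρ).sym2) := by
  refine ((determinedBy_openCrossing_image _ _ _ _).mono (Finset.coe_subset.2 (Finset.sym2_mono fun x hx => ?_))).inter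
    ((determinedBy_openCrossing_image _ _ _ _).mono (Finset.coe_subset.2 (Finset.sym2_mono fun x hx => ?_)))
  all_goals
    rw [Finset.mem_image] at hx
    obtain ⟨y, hy, rfl⟩ := hx
    rw [mem_rectangle_iff] at hy
    rw [mem_cornerSitesBot_iff]
    simp only [Pi.add_apply, Matrix.cons_val_zero, Matrix.cons_val_one, Nat.cast_mul, Nat.cast_ofNat] at hy ⊢
    omega

/-- The closed-dual top corner ring is read on the pairs of `cornerSitesTop` (`ρ ≥ 1`). [folklore] -/
theorem determinedBy_dualCornerRingTop (M N : ℕ) {ρ : ℕ} (hρ : 1 ≤ ρ) :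
    DeterminedBy (dualCornerRingTop M N ρ) ↑((cornerSitesTop M N ρ).sym2) := by
  refine ((determinedBy_dualLRFaceCrossing _ _ _).mono (Finset.coe_subset.2 (Finset.sym2_mono fun x hx => ?_))).inter
    ((determinedBy_dualTBFaceCrossing _ _ _).mono (Finset.coe_subset.2 (Finset.sym2_mono fun x hx => ?_)))
  all_goals
    obtain ⟨h1, h2, h3, h4⟩ := mem_Icc_dualLRFace_iff.1 hx
    simp only [Matrix.cons_val_zero, Matrix.cons_val_one, Nat.cast_sub hρ, Nat.cast_mul, Nat.cast_ofNat, Nat.cast_one] at h1 h2 h3 h4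
    rw [mem_cornerSitesTop_iff]
    omega

/-- The closed-dual bottom corner ring is read on the pairs of `cornerSitesBot` (`ρ ≥ 1`). [folklore] -/
theorem determinedBy_dualCornerRingBot (M : ℕ) {ρ : ℕ} (hρ : 1 ≤ ρ) :
    DeterminedBy (dualCornerRingBot M ρ) ↑((cornerSitesBot M ρ).sym2) := by
  refine ((determinedBy_dualLRFaceCrossing _ _ _).mono (Finset.coe_subset.2 (Finset.sym2_mono fun x hx => ?_))).inter
    ((determinedBy_dualTBFaceCrossing _ _ _).mono (Finset.coe_subset.2 (Finset.sym2_mono fun x hx => ?_)))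
  all_goals
    obtain ⟨h1, h2, h3, h4⟩ := mem_Icc_dualLRFace_iff.1 hx
    simp only [Matrix.cons_val_zero, Matrix.cons_val_one, Nat.cast_sub hρ, Nat.cast_mul, Nat.cast_ofNat, Nat.cast_one] at h1 h2 h3 h4
    rw [mem_cornerSitesBot_iff]
    omega

/-- Corner sites at scales `ρ` and `ρ' ≥ 4ρ` are disjoint (top). [folklore] -/
theorem disjoint_cornerSitesTop_of_le {ρ ρ' : ℕ} (hρ : 1 ≤ ρ) (h : 4 * ρ ≤ ρ') :
    Disjoint (cornerSitesTop M N ρ) (cornerSitesTop M N ρ') := by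
  rw [Finset.disjoint_left]
  intro x hx hx'
  rw [mem_cornerSitesTop_iff] at hx hx'
  omega

/-- Corner sites at scales `ρ` and `ρ' ≥ 4ρ` are disjoint (bottom). [folklore] -/
theorem disjoint_cornerSitesBot_of_le {ρ ρ' : ℕ} (hρ : 1 ≤ ρ) (h : 4 * ρ ≤ ρ') :
    Disjoint (cornerSitesBot M ρ) (cornerSitesBot M ρ') := by
  rw [Finset.disjoint_left]
  intro x hx hx'
  rw [mem_cornerSitesBot_iff] at hx hx'
  omega

/-- Pairs of disjoint site sets are disjoint. [folklore] -/
theorem disjoint_sym2_of_disjoint' {A B : Finset (Site 2)} (h : Disjoint A B) : Disjoint A.sym2 B.sym2 := by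
  rw [Finset.disjoint_left] at h ⊢
  intro e he he'
  induction e using Sym2.ind with
  | h x y => exact h (Finset.mk_mem_sym2_iff.1 he).1 (Finset.mk_mem_sym2_iff.1 he').1

/-- The pairs of corner sites along the scales `r 4^k` are pairwise disjoint (top). [folklore] -/
theorem disjoint_cornerSitesTop_sym2_pow {r : ℕ} (hr : 1 ≤ r) {k l : ℕ} (hkl : k ≠ l) :
    Disjoint (cornerSitesTop M N (r * 4 ^ k)).sym2 (cornerSitesTop M N (r * 4 ^ l)).sym2 := by
  have key : ∀ {k l : ℕ}, k < l → Disjoint (cornerSitesTop M N (r * 4 ^ k)).sym2 (cornerSitesTop M N (r * 4 ^ l)).sym2 :=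
    fun {k l} hkl => disjoint_sym2_of_disjoint' (disjoint_cornerSitesTop_of_le
      (Nat.le_mul_of_pos_right _ (by positivity) |>.trans' hr) (by
        calc 4 * (r * 4 ^ k) = r * 4 ^ (k + 1) := by ring
          _ ≤ r * 4 ^ l := Nat.mul_le_mul_left _ (Nat.pow_le_pow_right (by norm_num) hkl)))
  rcases Nat.lt_or_gt_of_ne hkl with h | h
  · exact key h
  · exact (key h).symm

/-- The pairs of corner sites along the scales `r 4^k` are pairwise disjoint (bottom). [folklore] -/
theorem disjoint_cornerSitesBot_sym2_pow {r : ℕ} (hr : 1 ≤ r) {k l : ℕ} (hkl : k ≠ l) :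
    Disjoint (cornerSitesBot M (r * 4 ^ k)).sym2 (cornerSitesBot M (r * 4 ^ l)).sym2 := by
  have key : ∀ {k l : ℕ}, k < l → Disjoint (cornerSitesBot M (r * 4 ^ k)).sym2 (cornerSitesBot M (r * 4 ^ l)).sym2 :=
    fun {k l} hkl => disjoint_sym2_of_disjoint' (disjoint_cornerSitesBot_of_le
      (Nat.le_mul_of_pos_right _ (by positivity) |>.trans' hr) (by
        calc 4 * (r * 4 ^ k) = r * 4 ^ (k + 1) := by ring
          _ ≤ r * 4 ^ l := Nat.mul_le_mul_left _ (Nat.pow_le_pow_right (by norm_num) hkl)))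
  rcases Nat.lt_or_gt_of_ne hkl with h | h
  · exact key h
  · exact (key h).symm

/-! ### No corner ring at `K` scales -/

/-- The trivial event is read on no pair. [folklore] -/
theorem determinedBy_univ_empty : DeterminedBy (Set.univ : Set (BondConfig (Site 2))) ↑(∅ : Finset (Sym2 (Site 2))) := by
  rw [determinedBy_iff]; intro ω ω' _; simp

/-- **No ring of an independent family at `K` scales has probability `≤ (1 - c)^K`.** [folklore] -/
theorem real_biInter_compl_le (G : ℕ → Set (BondConfig (Site 2))) (T : ℕ → Finset (Sym2 (Site 2)))
    (hG : ∀ k, DeterminedBy (G k) ↑(T k)) (hGm : ∀ k, MeasurableSet (G k))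
    (hTT : ∀ k l, k ≠ l → Disjoint (T k) (T l)) (K : ℕ) {c : ℝ}
    (hc : ∀ k, k < K → c ≤ (bondPercolation (zdGraph 2) half).real (G k)) :
    (bondPercolation (zdGraph 2) half).real (⋂ k ∈ Finset.range K, (G k)ᶜ) ≤ (1 - c) ^ K := by
  have h := real_inter_biInter_compl_le half determinedBy_univ_empty MeasurableSet.univ G T hG hGm
    (fun k => Finset.disjoint_empty_right _) hTT (K := K) hc
  rwa [Set.univ_inter, probReal_univ, one_mul] at h

/-- **No open top corner ring at `K` scales: probability `≤ (1 - c²)^K`.** [cite: Nolin2008, §4.4, proof of Lemma 15 (arXiv 0711.4948: Lemma 14, p. 11)] -/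
theorem real_noCornerRingTop_le {c : ℝ} (hc0 : 0 ≤ c) (hc : ∀ l : ℕ, 1 ≤ l → c ≤ crossingProb half (7 * l - 1) (l - 1))
    (M N : ℕ) {r : ℕ} (hr : 1 ≤ r) (K : ℕ) :
    (bondPercolation (zdGraph 2) half).real (⋂ k ∈ Finset.range K, (cornerRingTop M N (r * 4 ^ k))ᶜ) ≤ (1 - c ^ 2) ^ K :=
  real_biInter_compl_le _ _ (fun _ => determinedBy_cornerRingTop _ _ _) (fun _ => measurableSet_cornerRingTop _ _ _)
    (fun _ _ hkl => disjoint_cornerSitesTop_sym2_pow hr hkl) K fun _ _ => le_real_cornerRingTop hc0 hc _ _ _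

/-- **No open bottom corner ring at `K` scales: probability `≤ (1 - c²)^K`.** [cite: Nolin2008, §4.4, proof of Lemma 15 (arXiv 0711.4948: Lemma 14, p. 11)] -/
theorem real_noCornerRingBot_le {c : ℝ} (hc0 : 0 ≤ c) (hc : ∀ l : ℕ, 1 ≤ l → c ≤ crossingProb half (7 * l - 1) (l - 1))
    (M : ℕ) {r : ℕ} (hr : 1 ≤ r) (K : ℕ) :
    (bondPercolation (zdGraph 2) half).real (⋂ k ∈ Finset.range K, (cornerRingBot M (r * 4 ^ k))ᶜ) ≤ (1 - c ^ 2) ^ K :=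
  real_biInter_compl_le _ _ (fun _ => determinedBy_cornerRingBot _ _) (fun _ => measurableSet_cornerRingBot _ _)
    (fun _ _ hkl => disjoint_cornerSitesBot_sym2_pow hr hkl) K fun _ _ => le_real_cornerRingBot hc0 hc _ _

/-- **No closed-dual top corner ring at `K` scales: probability `≤ (1 - c²)^K`.** [cite: Nolin2008, §4.4, proof of Lemma 15 (arXiv 0711.4948: Lemma 14, p. 11)] -/
theorem real_noDualCornerRingTop_le {c : ℝ} (hc0 : 0 ≤ c) (hc : ∀ l : ℕ, 1 ≤ l → c ≤ crossingProb half (7 * l - 1) (l - 1))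
    (M N : ℕ) {r : ℕ} (hr : 1 ≤ r) (K : ℕ) :
    (bondPercolation (zdGraph 2) half).real (⋂ k ∈ Finset.range K, (dualCornerRingTop M N (r * 4 ^ k))ᶜ) ≤ (1 - c ^ 2) ^ K :=
  have hrk : ∀ k, 1 ≤ r * 4 ^ k := fun k => Nat.le_mul_of_pos_right _ (by positivity) |>.trans' hr
  real_biInter_compl_le _ _ (fun k => determinedBy_dualCornerRingTop _ _ (hrk k)) (fun _ => measurableSet_dualCornerRingTop _ _ _)
    (fun _ _ hkl => disjoint_cornerSitesTop_sym2_pow hr hkl) K fun k _ => le_real_dualCornerRingTop hc0 hc _ _ (hrk k)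

/-- **No closed-dual bottom corner ring at `K` scales: probability `≤ (1 - c²)^K`.** [cite: Nolin2008, §4.4, proof of Lemma 15 (arXiv 0711.4948: Lemma 14, p. 11)] -/
theorem real_noDualCornerRingBot_le {c : ℝ} (hc0 : 0 ≤ c) (hc : ∀ l : ℕ, 1 ≤ l → c ≤ crossingProb half (7 * l - 1) (l - 1))
    (M : ℕ) {r : ℕ} (hr : 1 ≤ r) (K : ℕ) :
    (bondPercolation (zdGraph 2) half).real (⋂ k ∈ Finset.range K, (dualCornerRingBot M (r * 4 ^ k))ᶜ) ≤ (1 - c ^ 2) ^ K :=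
  have hrk : ∀ k, 1 ≤ r * 4 ^ k := fun k => Nat.le_mul_of_pos_right _ (by positivity) |>.trans' hr
  real_biInter_compl_le _ _ (fun k => determinedBy_dualCornerRingBot _ (hrk k)) (fun _ => measurableSet_dualCornerRingBot _ _)
    (fun _ _ hkl => disjoint_cornerSitesBot_sym2_pow hr hkl) K fun k _ => le_real_dualCornerRingBot hc0 hc _ (hrk k)

/-! ### Barriers: open corner rings block closed-dual face walks inside `R` -/

/-- **The open top corner ring blocks closed-dual face walks inside `R`**: if `ω ∈ cornerRingTop M N ρ`
(`ρ ≥ 1`, lattice `ω`), no walk of faces inside `R` (`f₀ ≤ M-1`, `f₁ ≤ N-1`) whose steps cross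
`ω`-closed edges joins a face with `f₀ ≥ M-ρ`, `f₁ ≥ N-ρ` to a face with `f₀ < M-2ρ` or `f₁ < N-2ρ`.
[cite: BollobasRiordan2006, Ch. 3, Lemma 1] -/
theorem cornerRingTop_blocks_faceWalk (hωE : ω ⊆ (zdGraph 2).edgeSet) {ρ : ℕ} (hρ : 1 ≤ ρ)
    (hring : ω ∈ cornerRingTop M N ρ) {f g : Site 2} (δ : (zdGraph 2).Walk f g)
    (hδ : ∀ d ∈ δ.darts, sepEdge d.fst d.snd ∉ ω) (hδR : ∀ z ∈ δ.support, z 0 + 1 ≤ M ∧ z 1 + 1 ≤ N)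
    (hf : (M : ℤ) - ρ ≤ f 0 ∧ (N : ℤ) - ρ ≤ f 1) (hg : ¬ ((M : ℤ) - 2 * ρ ≤ g 0 ∧ (N : ℤ) - 2 * ρ ≤ g 1)) : False := by
  classical
  obtain ⟨hH, hV⟩ := hring
  obtain ⟨xp, yp, Tp, hxp, hyp, hTps, hTpe⟩ := exists_walk_of_mem_lrCrossingAt hωE hH
  obtain ⟨xv, yv, Tv, hxv, hyv, hTvs, hTve⟩ := exists_walk_of_mem_tbCrossingAt hωE hV
  simp only [Matrix.cons_val_zero, Matrix.cons_val_one, Nat.cast_mul, Nat.cast_ofNat] at hxp hyp hTps hxv hyv hTvs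
  set A : Set (Site 2) := {h | (M : ℤ) - 2 * ρ ≤ h 0 ∧ (N : ℤ) - 2 * ρ ≤ h 1} with hA
  obtain ⟨x, y, δ₁, hxy, hy, hδ₁A, hδ₁S, hδ₁E, hlast⟩ :=
    exists_prefix_exit (A := A) δ (by simp only [hA, Set.mem_setOf_eq]; omega) hg
  have hx : x ∈ A := hδ₁A x δ₁.end_mem_support
  simp only [hA, Set.mem_setOf_eq] at hx hy hδ₁A
  have hyδ : y ∈ δ.support := δ.snd_mem_support_of_mem_edges hlast
  set δ₂ := δ₁.concat hxy with hδ₂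
  have hδ₂e : ∀ e ∈ δ₂.edges, e ∈ δ.edges := by
    intro e he
    rw [hδ₂, Walk.edges_concat, List.concat_eq_append, List.mem_append, List.mem_singleton] at he
    rcases he with he | rfl
    · exact hδ₁E e he
    · exact hlast
  have hδ₂s : ∀ z ∈ δ₂.support, (z ∈ δ₁.support ∨ z = y) ∧ z ∈ δ.support := by
    intro z hz
    rw [hδ₂, Walk.support_concat, List.mem_append, List.mem_singleton] at hz
    rcases hz with hz | rfl
    · exact ⟨Or.inl hz, hδ₁S z hz⟩
    · exact ⟨Or.inr rfl, hyδ⟩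
  have hclosed : ∀ {p q : Site 2} (U : (zdGraph 2).Walk p q), (∀ e ∈ U.edges, e ∈ δ₂.edges) →
      ∀ d ∈ U.darts, sepEdge d.fst d.snd ∉ ω := fun U hU d hd =>
    sepEdge_not_mem_of_mk_mem_edges hδ (hδ₂e _ (hU _ (by rw [Walk.edges]; exact List.mem_map.2 ⟨d, hd, rfl⟩)))
  have hstep := zdGraph_adj_apply_le hxy
  have h0 := hstep 0
  have h1 := hstep 1
  by_cases hbot : (N : ℤ) - 2 * ρ > y 1
  · -- exit through the bottom: cross the left–right crossing
    have hy1 : y 1 = N - 2 * ρ - 1 := by omega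
    have hy0 : y 0 = x 0 := by
      rcases stepKind_of_adj hxy with ⟨h0', h1'⟩ | ⟨h0', h1'⟩ | ⟨h1', h0'⟩ | ⟨h1', h0'⟩ <;> omega
    obtain ⟨p, q, U, hp, hq, hUs, hUe⟩ := exists_segment_between 1 δ₂.reverse ((N : ℤ) - 2 * ρ - 1) ((N : ℤ) - ρ)
      (by show y 1 ≤ (N : ℤ) - 2 * ρ - 1; omega) (by omega) (by omega)
    obtain ⟨dq, hdq, hsep⟩ := exists_dart_sepEdge_mem_edges_lr_box (L := (M : ℤ) - 2 * ρ) (R := (M : ℤ))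
      (B := (N : ℤ) - 2 * ρ) (T := (N : ℤ) - ρ) Tp U.reverse (fun z hz => by have := hTps z hz; omega)
      (fun z hz => by
        rw [Walk.support_reverse, List.mem_reverse] at hz
        have h3 := hUs z hz
        have h5 : z ∈ δ₂.support := by have := h3.2.2; rwa [Walk.support_reverse, List.mem_reverse] at this
        have h6 := hδR z (hδ₂s z h5).2
        rcases (hδ₂s z h5).1 with h4 | rfl
        · have := hδ₁A z h4; omega
        · omega)
      hxp (by omega) hq (by omega)
    refine hclosed U.reverse (fun e he => ?_) dq hdq (hTpe _ hsep)
    have := hUe e (by rwa [Walk.edges_reverse, List.mem_reverse] at he)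
    rwa [Walk.edges_reverse, List.mem_reverse] at this
  · -- exit through the left: cross the top–bottom crossing
    have hy0 : y 0 = (M : ℤ) - 2 * ρ - 1 := by omega
    have hy1 : y 1 = x 1 := by
      rcases stepKind_of_adj hxy with ⟨h0', h1'⟩ | ⟨h0', h1'⟩ | ⟨h1', h0'⟩ | ⟨h1', h0'⟩ <;> omega
    obtain ⟨p, q, U, hp, hq, hUs, hUe⟩ := exists_segment_between 0 δ₂.reverse ((M : ℤ) - 2 * ρ - 1) ((M : ℤ) - ρ)
      (by show y 0 ≤ (M : ℤ) - 2 * ρ - 1; omega) (by omega) (by omega)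
    obtain ⟨dq, hdq, hsep⟩ := KSTPeriodic.exists_dart_sepEdge_mem_edges_box (L := (M : ℤ) - 2 * ρ) (R := (M : ℤ) - ρ)
      (B := (N : ℤ) - 2 * ρ) (T := (N : ℤ)) Tv U.reverse (fun z hz => by have := hTvs z hz; omega)
      (fun z hz => by
        rw [Walk.support_reverse, List.mem_reverse] at hz
        have h3 := hUs z hz
        have h5 : z ∈ δ₂.support := by have := h3.2.2; rwa [Walk.support_reverse, List.mem_reverse] at this
        have h6 := hδR z (hδ₂s z h5).2
        rcases (hδ₂s z h5).1 with h4 | rfl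
        · have := hδ₁A z h4; omega
        · omega)
      hxv (by omega) hq (by omega)
    refine hclosed U.reverse (fun e he => ?_) dq hdq (hTve _ hsep)
    have := hUe e (by rwa [Walk.edges_reverse, List.mem_reverse] at he)
    rwa [Walk.edges_reverse, List.mem_reverse] at this

/-- **The open bottom corner ring blocks closed-dual face walks inside `R`**: if `ω ∈ cornerRingBot M ρ`
(`ρ ≥ 1`, lattice `ω`), no walk of faces inside `R` (`f₀ ≤ M-1`, `0 ≤ f₁`) whose steps cross
`ω`-closed edges joins a face with `f₀ ≥ M-ρ`, `f₁ ≤ ρ-1` to a face with `f₀ < M-2ρ` or `f₁ ≥ 2ρ`.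
[cite: BollobasRiordan2006, Ch. 3, Lemma 1] -/
theorem cornerRingBot_blocks_faceWalk (hωE : ω ⊆ (zdGraph 2).edgeSet) {ρ : ℕ} (hρ : 1 ≤ ρ)
    (hring : ω ∈ cornerRingBot M ρ) {f g : Site 2} (δ : (zdGraph 2).Walk f g)
    (hδ : ∀ d ∈ δ.darts, sepEdge d.fst d.snd ∉ ω) (hδR : ∀ z ∈ δ.support, z 0 + 1 ≤ M ∧ 0 ≤ z 1)
    (hf : (M : ℤ) - ρ ≤ f 0 ∧ f 1 + 1 ≤ ρ) (hg : ¬ ((M : ℤ) - 2 * ρ ≤ g 0 ∧ g 1 + 1 ≤ 2 * ρ)) : False := by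
  classical
  obtain ⟨hH, hV⟩ := hring
  obtain ⟨xp, yp, Tp, hxp, hyp, hTps, hTpe⟩ := exists_walk_of_mem_lrCrossingAt hωE hH
  obtain ⟨xv, yv, Tv, hxv, hyv, hTvs, hTve⟩ := exists_walk_of_mem_tbCrossingAt hωE hV
  simp only [Matrix.cons_val_zero, Matrix.cons_val_one, Nat.cast_mul, Nat.cast_ofNat] at hxp hyp hTps hxv hyv hTvs
  set A : Set (Site 2) := {h | (M : ℤ) - 2 * ρ ≤ h 0 ∧ h 1 + 1 ≤ 2 * ρ} with hA
  obtain ⟨x, y, δ₁, hxy, hy, hδ₁A, hδ₁S, hδ₁E, hlast⟩ :=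
    exists_prefix_exit (A := A) δ (by simp only [hA, Set.mem_setOf_eq]; omega) hg
  have hx : x ∈ A := hδ₁A x δ₁.end_mem_support
  simp only [hA, Set.mem_setOf_eq] at hx hy hδ₁A
  have hyδ : y ∈ δ.support := δ.snd_mem_support_of_mem_edges hlast
  set δ₂ := δ₁.concat hxy with hδ₂
  have hδ₂e : ∀ e ∈ δ₂.edges, e ∈ δ.edges := by
    intro e he
    rw [hδ₂, Walk.edges_concat, List.concat_eq_append, List.mem_append, List.mem_singleton] at he
    rcases he with he | rfl
    · exact hδ₁E e he
    · exact hlast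
  have hδ₂s : ∀ z ∈ δ₂.support, (z ∈ δ₁.support ∨ z = y) ∧ z ∈ δ.support := by
    intro z hz
    rw [hδ₂, Walk.support_concat, List.mem_append, List.mem_singleton] at hz
    rcases hz with hz | rfl
    · exact ⟨Or.inl hz, hδ₁S z hz⟩
    · exact ⟨Or.inr rfl, hyδ⟩
  have hclosed : ∀ {p q : Site 2} (U : (zdGraph 2).Walk p q), (∀ e ∈ U.edges, e ∈ δ₂.edges) →
      ∀ d ∈ U.darts, sepEdge d.fst d.snd ∉ ω := fun U hU d hd =>
    sepEdge_not_mem_of_mk_mem_edges hδ (hδ₂e _ (hU _ (by rw [Walk.edges]; exact List.mem_map.2 ⟨d, hd, rfl⟩)))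
  have hstep := zdGraph_adj_apply_le hxy
  have h0 := hstep 0
  have h1 := hstep 1
  by_cases htop : y 1 + 1 > 2 * (ρ : ℤ)
  · -- exit through the top: cross the left–right crossing
    have hy1 : y 1 = 2 * ρ := by omega
    have hy0 : y 0 = x 0 := by
      rcases stepKind_of_adj hxy with ⟨h0', h1'⟩ | ⟨h0', h1'⟩ | ⟨h1', h0'⟩ | ⟨h1', h0'⟩ <;> omega
    obtain ⟨p, q, U, hp, hq, hUs, hUe⟩ := exists_segment_between 1 δ₂ ((ρ : ℤ) - 1) (2 * (ρ : ℤ)) (by omega)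
      (by show 2 * (ρ : ℤ) ≤ y 1; omega) (by omega)
    obtain ⟨dq, hdq, hsep⟩ := exists_dart_sepEdge_mem_edges_lr_box (L := (M : ℤ) - 2 * ρ) (R := (M : ℤ))
      (B := (ρ : ℤ)) (T := 2 * (ρ : ℤ)) Tp U.reverse (fun z hz => by have := hTps z hz; omega)
      (fun z hz => by
        rw [Walk.support_reverse, List.mem_reverse] at hz
        have h3 := hUs z hz
        have h6 := hδR z (hδ₂s z h3.2.2).2
        rcases (hδ₂s z h3.2.2).1 with h4 | rfl
        · have := hδ₁A z h4; omega
        · omega)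
      hxp (by omega) hq (by omega)
    exact hclosed U.reverse (fun e he => hUe e (by rwa [Walk.edges_reverse, List.mem_reverse] at he)) dq hdq (hTpe _ hsep)
  · -- exit through the left: cross the top–bottom crossing
    have hy0 : y 0 = (M : ℤ) - 2 * ρ - 1 := by omega
    have hy1 : y 1 = x 1 := by
      rcases stepKind_of_adj hxy with ⟨h0', h1'⟩ | ⟨h0', h1'⟩ | ⟨h1', h0'⟩ | ⟨h1', h0'⟩ <;> omega
    obtain ⟨p, q, U, hp, hq, hUs, hUe⟩ := exists_segment_between 0 δ₂.reverse ((M : ℤ) - 2 * ρ - 1) ((M : ℤ) - ρ)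
      (by show y 0 ≤ (M : ℤ) - 2 * ρ - 1; omega) (by omega) (by omega)
    obtain ⟨dq, hdq, hsep⟩ := KSTPeriodic.exists_dart_sepEdge_mem_edges_box (L := (M : ℤ) - 2 * ρ) (R := (M : ℤ) - ρ)
      (B := (0 : ℤ)) (T := 2 * (ρ : ℤ)) Tv U.reverse (fun z hz => by have := hTvs z hz; omega)
      (fun z hz => by
        rw [Walk.support_reverse, List.mem_reverse] at hz
        have h3 := hUs z hz
        have h5 : z ∈ δ₂.support := by have := h3.2.2; rwa [Walk.support_reverse, List.mem_reverse] at this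
        have h6 := hδR z (hδ₂s z h5).2
        rcases (hδ₂s z h5).1 with h4 | rfl
        · have := hδ₁A z h4; omega
        · omega)
      hxv (by omega) hq (by omega)
    refine hclosed U.reverse (fun e he => ?_) dq hdq (hTve _ hsep)
    have := hUe e (by rwa [Walk.edges_reverse, List.mem_reverse] at he)
    rwa [Walk.edges_reverse, List.mem_reverse] at this

/-! ### Barriers: closed-dual corner rings block open walks of `R` -/

/-- **The closed-dual top corner ring blocks open walks of `R`**: if `ω ∈ dualCornerRingTop M N ρ`
(`ρ ≥ 1`), no `ω`-open walk of sites of `R` (`x ≤ M`, `y ≤ N`) joins a site with `x ≥ M-ρ`,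
`y ≥ N-ρ` to a site with `x ≤ M-2ρ` or `y ≤ N-2ρ`. [cite: BollobasRiordan2006, Ch. 3, Lemma 1] -/
theorem dualCornerRingTop_blocks_walk {ρ : ℕ} (hρ : 1 ≤ ρ) (hring : ω ∈ dualCornerRingTop M N ρ)
    {p q : Site 2} (π : (zdGraph 2).Walk p q) (hπ : ∀ e ∈ π.edges, e ∈ ω)
    (hπR : ∀ z ∈ π.support, z 0 ≤ M ∧ z 1 ≤ N) (hp : (M : ℤ) - ρ ≤ p 0 ∧ (N : ℤ) - ρ ≤ p 1)
    (hq : ¬ ((M : ℤ) - 2 * ρ + 1 ≤ q 0 ∧ (N : ℤ) - 2 * ρ + 1 ≤ q 1)) : False := by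
  classical
  have h12 : 1 ≤ 2 * ρ := by omega
  obtain ⟨hH, hV⟩ := hring
  obtain ⟨ah, bh, Wh, hah, hbh, hWhs, hWhd⟩ := hH
  obtain ⟨av, bv, Wv, hav, hbv, hWvs, hWvd⟩ := hV
  simp only [Matrix.cons_val_zero, Matrix.cons_val_one, Nat.cast_mul, Nat.cast_ofNat, Nat.cast_sub hρ, Nat.cast_one] at hah hbh hWhs hav hbv hWvs
  set A : Set (Site 2) := {v | (M : ℤ) - 2 * ρ + 1 ≤ v 0 ∧ (N : ℤ) - 2 * ρ + 1 ≤ v 1} with hA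
  obtain ⟨x, y, π₁, hxy, hy, hπ₁A, hπ₁S, hπ₁E, hlast⟩ :=
    exists_prefix_exit (A := A) π (by simp only [hA, Set.mem_setOf_eq]; omega) hq
  have hx : x ∈ A := hπ₁A x π₁.end_mem_support
  simp only [hA, Set.mem_setOf_eq] at hx hy hπ₁A
  have hyπ : y ∈ π.support := π.snd_mem_support_of_mem_edges hlast
  set π₂ := π₁.concat hxy with hπ₂
  have hπ₂e : ∀ e ∈ π₂.edges, e ∈ ω := by
    intro e he
    rw [hπ₂, Walk.edges_concat, List.concat_eq_append, List.mem_append, List.mem_singleton] at he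
    rcases he with he | rfl
    · exact hπ e (hπ₁E e he)
    · exact hπ _ hlast
  have hπ₂s : ∀ z ∈ π₂.support, (z ∈ π₁.support ∨ z = y) ∧ z ∈ π.support := by
    intro z hz
    rw [hπ₂, Walk.support_concat, List.mem_append, List.mem_singleton] at hz
    rcases hz with hz | rfl
    · exact ⟨Or.inl hz, hπ₁S z hz⟩
    · exact ⟨Or.inr rfl, hyπ⟩
  have hstep := zdGraph_adj_apply_le hxy
  have h0 := hstep 0
  have h1 := hstep 1
  have hrev : ∀ {a b : Site 2} {W : (zdGraph 2).Walk a b}, (∀ d ∈ W.darts, sepEdge d.fst d.snd ∉ ω) →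
      ∀ d ∈ W.reverse.darts, sepEdge d.fst d.snd ∉ ω := fun {a b W} hW d hd =>
    sepEdge_not_mem_of_mk_mem_edges hW (by
      have : s(d.fst, d.snd) ∈ W.reverse.edges := by rw [Walk.edges]; exact List.mem_map.2 ⟨d, hd, rfl⟩
      rwa [Walk.edges_reverse, List.mem_reverse] at this)
  by_cases hbot : (N : ℤ) - 2 * ρ + 1 > y 1
  · -- exit through the bottom: cross the closed-dual left–right crossing
    have hy1 : y 1 = N - 2 * ρ := by omega
    have hy0 : y 0 = x 0 := by
      rcases stepKind_of_adj hxy with ⟨h0', h1'⟩ | ⟨h0', h1'⟩ | ⟨h1', h0'⟩ | ⟨h1', h0'⟩ <;> omega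
    obtain ⟨p', q', U, hp', hq', hUs, hUe⟩ := exists_segment_between 1 π₂.reverse ((N : ℤ) - 2 * ρ) ((N : ℤ) - ρ)
      (by show y 1 ≤ (N : ℤ) - 2 * ρ; omega) (by omega) (by omega)
    obtain ⟨dq, hdq, hsep⟩ := KSTPeriodic.exists_dart_sepEdge_mem_edges_box (L := (M : ℤ) - 2 * ρ + 1)
      (R := (M : ℤ)) (B := (N : ℤ) - 2 * ρ) (T := (N : ℤ) - ρ) U Wh.reverse
      (fun z hz => by
        have h3 := hUs z hz
        have h5 : z ∈ π₂.support := by have := h3.2.2; rwa [Walk.support_reverse, List.mem_reverse] at this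
        have h6 := hπR z (hπ₂s z h5).2
        rcases (hπ₂s z h5).1 with h4 | rfl
        · have := hπ₁A z h4; omega
        · omega)
      (fun z hz => by
        rw [Walk.support_reverse, List.mem_reverse] at hz
        have := hWhs z hz; omega)
      hp' hq' (by omega) (by omega)
    refine hrev hWhd dq hdq (hπ₂e _ ?_)
    have := hUe _ hsep
    rwa [Walk.edges_reverse, List.mem_reverse] at this
  · -- exit through the left: cross the closed-dual top–bottom crossing
    have hy0 : y 0 = (M : ℤ) - 2 * ρ := by omega
    have hy1 : y 1 = x 1 := by
      rcases stepKind_of_adj hxy with ⟨h0', h1'⟩ | ⟨h0', h1'⟩ | ⟨h1', h0'⟩ | ⟨h1', h0'⟩ <;> omega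
    obtain ⟨p', q', U, hp', hq', hUs, hUe⟩ := exists_segment_between 0 π₂.reverse ((M : ℤ) - 2 * ρ) ((M : ℤ) - ρ)
      (by show y 0 ≤ (M : ℤ) - 2 * ρ; omega) (by omega) (by omega)
    obtain ⟨dq, hdq, hsep⟩ := exists_dart_sepEdge_mem_edges_lr_box (L := (M : ℤ) - 2 * ρ) (R := (M : ℤ) - ρ)
      (B := (N : ℤ) - 2 * ρ + 1) (T := (N : ℤ)) U Wv.reverse
      (fun z hz => by
        have h3 := hUs z hz
        have h5 : z ∈ π₂.support := by have := h3.2.2; rwa [Walk.support_reverse, List.mem_reverse] at this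
        have h6 := hπR z (hπ₂s z h5).2
        rcases (hπ₂s z h5).1 with h4 | rfl
        · have := hπ₁A z h4; omega
        · omega)
      (fun z hz => by
        rw [Walk.support_reverse, List.mem_reverse] at hz
        have := hWvs z hz; omega)
      hp' hq' (by omega) (by omega)
    refine hrev hWvd dq hdq (hπ₂e _ ?_)
    have := hUe _ hsep
    rwa [Walk.edges_reverse, List.mem_reverse] at this

/-- **The closed-dual bottom corner ring blocks open walks of `R`**: if `ω ∈ dualCornerRingBot M ρ`
(`ρ ≥ 1`), no `ω`-open walk of sites of `R` (`x ≤ M`, `0 ≤ y`) joins a site with `x ≥ M-ρ`, `y ≤ ρ`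
to a site with `x ≤ M-2ρ` or `y ≥ 2ρ`. [cite: BollobasRiordan2006, Ch. 3, Lemma 1] -/
theorem dualCornerRingBot_blocks_walk {ρ : ℕ} (hρ : 1 ≤ ρ) (hring : ω ∈ dualCornerRingBot M ρ)
    {p q : Site 2} (π : (zdGraph 2).Walk p q) (hπ : ∀ e ∈ π.edges, e ∈ ω)
    (hπR : ∀ z ∈ π.support, z 0 ≤ M ∧ 0 ≤ z 1) (hp : (M : ℤ) - ρ ≤ p 0 ∧ p 1 ≤ ρ)
    (hq : ¬ ((M : ℤ) - 2 * ρ + 1 ≤ q 0 ∧ q 1 + 1 ≤ 2 * ρ)) : False := by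
  classical
  have h12 : 1 ≤ 2 * ρ := by omega
  obtain ⟨hH, hV⟩ := hring
  obtain ⟨ah, bh, Wh, hah, hbh, hWhs, hWhd⟩ := hH
  obtain ⟨av, bv, Wv, hav, hbv, hWvs, hWvd⟩ := hV
  simp only [Matrix.cons_val_zero, Matrix.cons_val_one, Nat.cast_mul, Nat.cast_ofNat, Nat.cast_sub hρ, Nat.cast_one] at hah hbh hWhs hav hbv hWvs
  set A : Set (Site 2) := {v | (M : ℤ) - 2 * ρ + 1 ≤ v 0 ∧ v 1 + 1 ≤ 2 * ρ} with hA
  obtain ⟨x, y, π₁, hxy, hy, hπ₁A, hπ₁S, hπ₁E, hlast⟩ :=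
    exists_prefix_exit (A := A) π (by simp only [hA, Set.mem_setOf_eq]; omega) hq
  have hx : x ∈ A := hπ₁A x π₁.end_mem_support
  simp only [hA, Set.mem_setOf_eq] at hx hy hπ₁A
  have hyπ : y ∈ π.support := π.snd_mem_support_of_mem_edges hlast
  set π₂ := π₁.concat hxy with hπ₂
  have hπ₂e : ∀ e ∈ π₂.edges, e ∈ ω := by
    intro e he
    rw [hπ₂, Walk.edges_concat, List.concat_eq_append, List.mem_append, List.mem_singleton] at he
    rcases he with he | rfl
    · exact hπ e (hπ₁E e he)
    · exact hπ _ hlast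
  have hπ₂s : ∀ z ∈ π₂.support, (z ∈ π₁.support ∨ z = y) ∧ z ∈ π.support := by
    intro z hz
    rw [hπ₂, Walk.support_concat, List.mem_append, List.mem_singleton] at hz
    rcases hz with hz | rfl
    · exact ⟨Or.inl hz, hπ₁S z hz⟩
    · exact ⟨Or.inr rfl, hyπ⟩
  have hstep := zdGraph_adj_apply_le hxy
  have h0 := hstep 0
  have h1 := hstep 1
  have hrev : ∀ {a b : Site 2} {W : (zdGraph 2).Walk a b}, (∀ d ∈ W.darts, sepEdge d.fst d.snd ∉ ω) →
      ∀ d ∈ W.reverse.darts, sepEdge d.fst d.snd ∉ ω := fun {a b W} hW d hd =>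
    sepEdge_not_mem_of_mk_mem_edges hW (by
      have : s(d.fst, d.snd) ∈ W.reverse.edges := by rw [Walk.edges]; exact List.mem_map.2 ⟨d, hd, rfl⟩
      rwa [Walk.edges_reverse, List.mem_reverse] at this)
  by_cases htop : y 1 + 1 > 2 * (ρ : ℤ)
  · -- exit through the top: cross the closed-dual left–right crossing
    have hy1 : y 1 = 2 * ρ := by omega
    have hy0 : y 0 = x 0 := by
      rcases stepKind_of_adj hxy with ⟨h0', h1'⟩ | ⟨h0', h1'⟩ | ⟨h1', h0'⟩ | ⟨h1', h0'⟩ <;> omega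
    obtain ⟨p', q', U, hp', hq', hUs, hUe⟩ := exists_segment_between 1 π₂ (ρ : ℤ) (2 * (ρ : ℤ)) (by omega)
      (by show 2 * (ρ : ℤ) ≤ y 1; omega) (by omega)
    obtain ⟨dq, hdq, hsep⟩ := KSTPeriodic.exists_dart_sepEdge_mem_edges_box (L := (M : ℤ) - 2 * ρ + 1)
      (R := (M : ℤ)) (B := (ρ : ℤ)) (T := 2 * (ρ : ℤ)) U Wh.reverse
      (fun z hz => by
        have h3 := hUs z hz
        have h6 := hπR z (hπ₂s z h3.2.2).2
        rcases (hπ₂s z h3.2.2).1 with h4 | rfl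
        · have := hπ₁A z h4; omega
        · omega)
      (fun z hz => by
        rw [Walk.support_reverse, List.mem_reverse] at hz
        have := hWhs z hz; omega)
      hp' hq' (by omega) (by omega)
    exact hrev hWhd dq hdq (hπ₂e _ (hUe _ hsep))
  · -- exit through the left: cross the closed-dual top–bottom crossing
    have hy0 : y 0 = (M : ℤ) - 2 * ρ := by omega
    have hy1 : y 1 = x 1 := by
      rcases stepKind_of_adj hxy with ⟨h0', h1'⟩ | ⟨h0', h1'⟩ | ⟨h1', h0'⟩ | ⟨h1', h0'⟩ <;> omega
    obtain ⟨p', q', U, hp', hq', hUs, hUe⟩ := exists_segment_between 0 π₂.reverse ((M : ℤ) - 2 * ρ) ((M : ℤ) - ρ)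
      (by show y 0 ≤ (M : ℤ) - 2 * ρ; omega) (by omega) (by omega)
    obtain ⟨dq, hdq, hsep⟩ := exists_dart_sepEdge_mem_edges_lr_box (L := (M : ℤ) - 2 * ρ) (R := (M : ℤ) - ρ)
      (B := (0 : ℤ)) (T := 2 * (ρ : ℤ) - 1) U Wv.reverse
      (fun z hz => by
        have h3 := hUs z hz
        have h5 : z ∈ π₂.support := by have := h3.2.2; rwa [Walk.support_reverse, List.mem_reverse] at this
        have h6 := hπR z (hπ₂s z h5).2
        rcases (hπ₂s z h5).1 with h4 | rfl
        · have := hπ₁A z h4; omega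
        · omega)
      (fun z hz => by
        rw [Walk.support_reverse, List.mem_reverse] at hz
        have := hWvs z hz; omega)
      hp' hq' (by omega) (by omega)
    refine hrev hWvd dq hdq (hπ₂e _ ?_)
    have := hUe _ hsep
    rwa [Walk.edges_reverse, List.mem_reverse] at this

/-! ### Consequence: tips of realised objects stay away from the right corners -/

section Tips

variable {S T : Finset (Sym2 (Site 2))}

/-- **A closed-dual top corner ring keeps the tip of a realised open frontier below `N - ρ`.**
[cite: Nolin2008, §4.4, proof of Lemma 15 (arXiv 0711.4948: Lemma 14, p. 11)] -/
theorem IsFrontierSet.tipOf_add_lt_of_dualCornerRingTop (hS : IsFrontierSet M N S) (hM : 1 ≤ M)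
    (hω : ω ∈ frontierEvent M N S) {ρ : ℕ} (hρ : 1 ≤ ρ) (hρM : 2 * ρ + 1 ≤ M) (hring : ω ∈ dualCornerRingTop M N ρ) :
    (tipOf M N S) 1 + ρ + 1 ≤ N := by
  classical
  obtain ⟨Λ⟩ := nonempty_lowPath (ω := (↑S : BondConfig (Site 2))) hM hS.2
  rw [← Λ.b_eq_tipOf_coe hM hS.2]
  have hbR := mem_rectangle_iff.1 Λ.b_mem_rectangle
  by_contra hlt
  refine dualCornerRingTop_blocks_walk hρ hring Λ.path.reverse
    (fun e he => hω.1 (Finset.mem_coe.2 ((hS.mem_edges_iff Λ).1 (by rwa [Walk.edges_reverse, List.mem_reverse] at he))))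
    (fun z hz => ?_) ⟨by rw [Λ.right]; omega, by omega⟩ (by rw [Λ.left]; omega)
  have := mem_rectangle_iff.1 (Λ.mem_rectangle z (by rwa [Walk.support_reverse, List.mem_reverse] at hz))
  exact ⟨this.2.1, this.2.2.2⟩

/-- **A closed-dual bottom corner ring keeps the tip of a realised open frontier above `ρ`.**
[cite: Nolin2008, §4.4, proof of Lemma 15 (arXiv 0711.4948: Lemma 14, p. 11)] -/
theorem IsFrontierSet.lt_tipOf_of_dualCornerRingBot (hS : IsFrontierSet M N S) (hM : 1 ≤ M)
    (hω : ω ∈ frontierEvent M N S) {ρ : ℕ} (hρ : 1 ≤ ρ) (hρM : 2 * ρ + 1 ≤ M) (hring : ω ∈ dualCornerRingBot M ρ) :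
    (ρ : ℤ) + 1 ≤ (tipOf M N S) 1 := by
  classical
  obtain ⟨Λ⟩ := nonempty_lowPath (ω := (↑S : BondConfig (Site 2))) hM hS.2
  rw [← Λ.b_eq_tipOf_coe hM hS.2]
  have hbR := mem_rectangle_iff.1 Λ.b_mem_rectangle
  by_contra hlt
  refine dualCornerRingBot_blocks_walk hρ hring Λ.path.reverse
    (fun e he => hω.1 (Finset.mem_coe.2 ((hS.mem_edges_iff Λ).1 (by rwa [Walk.edges_reverse, List.mem_reverse] at he))))
    (fun z hz => ?_) ⟨by rw [Λ.right]; omega, by omega⟩ (by rw [Λ.left]; omega)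
  have := mem_rectangle_iff.1 (Λ.mem_rectangle z (by rwa [Walk.support_reverse, List.mem_reverse] at hz))
  exact ⟨this.2.1, this.2.2.1⟩

/-- **An open top corner ring keeps the tip of a realised closed-dual frontier (of the faces inside
`R`, dual frame) below `N - ρ - 1`.** [cite: Nolin2008, §4.4, proof of Lemma 15 (arXiv 0711.4948: Lemma 14, p. 11)] -/
theorem IsFrontierSet.tipOf_add_lt_of_cornerRingTop (hT : IsFrontierSet (M - 1) (N - 1) T) (hM : 2 ≤ M) (hN : 1 ≤ N)
    (hωE : ω ⊆ (zdGraph 2).edgeSet) (hωT : dualConfig ω ∈ frontierEvent (M - 1) (N - 1) T) {ρ : ℕ} (hρ : 1 ≤ ρ)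
    (hρM : 2 * ρ + 1 ≤ M) (hring : ω ∈ cornerRingTop M N ρ) : (tipOf (M - 1) (N - 1) T) 1 + ρ + 1 ≤ N := by
  classical
  have hM1 : 1 ≤ M - 1 := by omega
  have hcast : ((M - 1 : ℕ) : ℤ) = M - 1 := by push_cast [Nat.cast_sub (show 1 ≤ M by omega)]; ring
  have hcastN : ((N - 1 : ℕ) : ℤ) = N - 1 := by push_cast [Nat.cast_sub hN]; ring
  obtain ⟨Γ⟩ := nonempty_lowPath (ω := (↑T : BondConfig (Site 2))) hM1 hT.2
  rw [← Γ.b_eq_tipOf_coe hM1 hT.2]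
  have hbR := mem_rectangle_iff.1 Γ.b_mem_rectangle
  rw [hcast, hcastN] at hbR
  have hd : ∀ d ∈ Γ.path.darts, sepEdge d.fst d.snd ∉ ω :=
    (forall_edges_mem_dualConfig_iff Γ.path).1 fun e he => hωT.1 (Finset.mem_coe.2 ((hT.mem_edges_iff Γ).1 he))
  have hrev : ∀ d ∈ Γ.path.reverse.darts, sepEdge d.fst d.snd ∉ ω := fun d hd' =>
    sepEdge_not_mem_of_mk_mem_edges hd (by
      have : s(d.fst, d.snd) ∈ Γ.path.reverse.edges := by rw [Walk.edges]; exact List.mem_map.2 ⟨d, hd', rfl⟩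
      rwa [Walk.edges_reverse, List.mem_reverse] at this)
  by_contra hlt
  refine cornerRingTop_blocks_faceWalk hωE hρ hring Γ.path.reverse hrev (fun z hz => ?_)
    ⟨by rw [Γ.right, hcast]; omega, by omega⟩ (by rw [Γ.left]; omega)
  have := mem_rectangle_iff.1 (Γ.mem_rectangle z (by rwa [Walk.support_reverse, List.mem_reverse] at hz))
  rw [hcast, hcastN] at this
  omega

/-- **An open bottom corner ring keeps the tip of a realised closed-dual frontier above `ρ - 1`.**
[cite: Nolin2008, §4.4, proof of Lemma 15 (arXiv 0711.4948: Lemma 14, p. 11)] -/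
theorem IsFrontierSet.le_tipOf_of_cornerRingBot (hT : IsFrontierSet (M - 1) (N - 1) T) (hM : 2 ≤ M) (hN : 1 ≤ N)
    (hωE : ω ⊆ (zdGraph 2).edgeSet) (hωT : dualConfig ω ∈ frontierEvent (M - 1) (N - 1) T) {ρ : ℕ} (hρ : 1 ≤ ρ)
    (hρM : 2 * ρ + 1 ≤ M) (hring : ω ∈ cornerRingBot M ρ) : (ρ : ℤ) ≤ (tipOf (M - 1) (N - 1) T) 1 := by
  classical
  have hM1 : 1 ≤ M - 1 := by omega
  have hcast : ((M - 1 : ℕ) : ℤ) = M - 1 := by push_cast [Nat.cast_sub (show 1 ≤ M by omega)]; ring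
  have hcastN : ((N - 1 : ℕ) : ℤ) = N - 1 := by push_cast [Nat.cast_sub hN]; ring
  obtain ⟨Γ⟩ := nonempty_lowPath (ω := (↑T : BondConfig (Site 2))) hM1 hT.2
  rw [← Γ.b_eq_tipOf_coe hM1 hT.2]
  have hbR := mem_rectangle_iff.1 Γ.b_mem_rectangle
  rw [hcast, hcastN] at hbR
  have hd : ∀ d ∈ Γ.path.darts, sepEdge d.fst d.snd ∉ ω :=
    (forall_edges_mem_dualConfig_iff Γ.path).1 fun e he => hωT.1 (Finset.mem_coe.2 ((hT.mem_edges_iff Γ).1 he))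
  have hrev : ∀ d ∈ Γ.path.reverse.darts, sepEdge d.fst d.snd ∉ ω := fun d hd' =>
    sepEdge_not_mem_of_mk_mem_edges hd (by
      have : s(d.fst, d.snd) ∈ Γ.path.reverse.edges := by rw [Walk.edges]; exact List.mem_map.2 ⟨d, hd', rfl⟩
      rwa [Walk.edges_reverse, List.mem_reverse] at this)
  by_contra hlt
  refine cornerRingBot_blocks_faceWalk hωE hρ hring Γ.path.reverse hrev (fun z hz => ?_)
    ⟨by rw [Γ.right, hcast]; omega, by omega⟩ (by rw [Γ.left]; omega)
  have := mem_rectangle_iff.1 (Γ.mem_rectangle z (by rwa [Walk.support_reverse, List.mem_reverse] at hz))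
  rw [hcast, hcastN] at this
  omega

end Tips

end Literature.Probability.Percolation

end
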